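import Summits.HubbardSuperconductivity.HubbardSuperconductivity.Theorems.TwSourcedInertness.Negative.ThermalRowWalk
import Literature.MathematicalPhysics.QuantumLattice.TorusCooperSumLogBound

/-!
# Crux `TwSourcedInertness` (item `stmt-HubbardSuperconductivity-1696`): the thermal Cooper
# logarithm of the free sourced torus, and the `log β` of the crux is SHARP (refuted no-log variants)

* `torusRow_modeGain_sum_ge` — one good row (`cos k₂ ≥ 3/4`) of the `L`-torus at `μ = −2`,
  `h = 1/β` gains `≥ (L/(304πβ))(log β − log 128)` (there `ĝ_d ≤ −1/2` wherever `ξ ≥ 0`);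
* `free_gain_thermal_lower_bound` — for `L ≥ 400`, `β ≥ 128`, `L ≥ 2β`:
  `(log β − log 128)/(2736π β²) ≤ p̃_L(β,−2,0,1/β) − p̃_L(β,−2,0,0)` (the `≥ L/9` good rows
  `b ≤ L/9`): the FREE sourced torus carries the Cooper logarithm with the temperature as cutoff —
  also the `U = 0`, `|h| = T` corner of the sibling crux `TwSourcedCondensation`, with constants;
* `tw1696_noLog_disc_false`, `tw1696_noLog_false` — the crux with bound `C·h²` instead of
  `C(1+log β)h²` is FALSE, already inside the thermal disc `|h| ≤ 1/β` (statements inlined): witness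
  `μ = −2`, `β = 128·e^{2736π(C+2)}`, `U = min(U₀, a/(1+log β), 1/(2β²))`, `L = max(L₀, 400, ⌈2β⌉)`,
  `h = 1/β`. MESSAGE TO PROVERS: the `β`-dependence `C(1 + log β)` cannot be improved; any proof must
  exhibit `χ_d ≍ ρ_d log β`, and `stub_thermalDisc` inherits the logarithm.

Sources: Salmhofer 1999 §4.5.4; tree `TorusCooperSumRowWalk`, `TorusCooperSumLogBound`
(`sum_torusSite_two_eq`); siblings `FreeGain`, `ThermalRowWalk`.
-/

noncomputable section

namespace Summit.HubbardSuperconductivity.HubbardSuperconductivity.Theorems.TwSourcedInertness.Negative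

open Matrix Finset Literature.MathematicalPhysics.QuantumLattice Literature.Probability.LatticeModels

section LogLoadBearing

/-! ### J.3 One good row of the torus at `μ = −2` -/

/-- **One good row** (`cos k₂ ≥ 3/4`) of the `L`-torus at `μ = −2`, `h = 1/β`:
`Σ_a modeGain(a, b) ≥ (L/(304πβ))(log β − log 128)` — on such a row `ĝ_d ≤ −1/2` wherever
`ξ ≥ 0`, so the per-mode bound `ĝ_d²/(19βξ) ≥ 1/(76βξ)` feeds the thermal row walk. -/
theorem torusRow_modeGain_sum_ge {L : ℕ} [NeZero L] (hL : (400 : ℝ) ≤ L) {β : ℝ} (hβ : 128 ≤ β)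
    (hLβ : 2 * β ≤ L) (b : ZMod L) (hb : 3 / 4 ≤ Real.cos (2 * Real.pi * (b.val : ℝ) / L)) :
    (L : ℝ) / (304 * Real.pi * β) * (Real.log β - Real.log 128) ≤
      ∑ a : ZMod L, (Real.log ((1 + Real.cosh (β * Real.sqrt ((torusBand L ![a, b] - (-2)) ^ 2 + (2 * Real.sqrt 2 * (1 / β) * dWaveGap ![a, b]) ^ 2))) / 2) - Real.log ((1 + Real.cosh (β * (torusBand L ![a, b] - (-2)))) / 2)) := by
  have hπ := Real.pi_pos
  have hβ1 : 1 ≤ β := by linarith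
  have hβ0 : 0 < β := by linarith
  set t : ℝ := Real.cos (2 * Real.pi * (b.val : ℝ) / L) with ht
  have ht1 : t ≤ 1 := Real.cos_le_one _
  set c : ℝ := -2 * t + 2 with hc
  have hc' : |c| ≤ 3 / 2 := by
    rw [hc, abs_le]; constructor <;> linarith
  set g : ℕ → ℝ := fun n => -2 * Real.cos (2 * Real.pi * (n : ℝ) / L) + c with hg
  have key := cooperRow_thermal_sum_ge g (fun n => rfl) hc' hL hβ hLβ
  have hξ : ∀ a : ZMod L, torusBand L ![a, b] - (-2) = g a.val := by
    intro a
    simp only [hg, hc, ht, torusBand, latticeMomentum, Fin.sum_univ_two, Matrix.cons_val_zero,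
      Matrix.cons_val_one]
    ring
  have hgap : ∀ a : ZMod L, dWaveGap ![a, b] = Real.cos (2 * Real.pi * (a.val : ℝ) / L) - t := by
    intro a
    simp only [dWaveGap, latticeMomentum, Matrix.cons_val_zero, Matrix.cons_val_one, ht]
  have hcosa : ∀ a : ZMod L, Real.cos (2 * Real.pi * (a.val : ℝ) / L) = 1 - t - g a.val / 2 := by
    intro a
    simp only [hg, hc]
    ring
  -- per-mode lower bound by the thermal indicator function
  have hpt : ∀ a : ZMod L, (if 1 / β ≤ g a.val then 1 / (76 * β * g a.val) else 0) ≤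
      (Real.log ((1 + Real.cosh (β * Real.sqrt ((torusBand L ![a, b] - (-2)) ^ 2 + (2 * Real.sqrt 2 * (1 / β) * dWaveGap ![a, b]) ^ 2))) / 2) - Real.log ((1 + Real.cosh (β * (torusBand L ![a, b] - (-2)))) / 2)) := by
    intro a
    split_ifs with h
    · have hgpos : 0 < g a.val := lt_of_lt_of_le (by positivity) h
      have habs : |torusBand L ![a, b] - (-2)| = g a.val := by rw [hξ a, abs_of_pos hgpos]
      have hm := modeGain_thermal_lower_bound hβ1 (-2) (![a, b]) (by rw [habs]; exact h)
      rw [habs] at hm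
      refine le_trans ?_ hm
      have hgk : dWaveGap ![a, b] ≤ -(1 / 2) := by rw [hgap a, hcosa a]; linarith
      have hgk2 : 1 / 4 ≤ dWaveGap ![a, b] ^ 2 := by nlinarith
      rw [div_le_div_iff₀ (by positivity) (by positivity)]
      have hβg : 0 ≤ 76 * β * g a.val := by positivity
      have := mul_le_mul_of_nonneg_right hgk2 hβg
      nlinarith
    · exact modeGain_nonneg L hβ0.le (-2) (1 / β) _
  -- the indicator sum equals the row sum of J.2
  have hsum : (1 / (76 * β)) * ∑ n ∈ (Finset.range L).filter (fun n : ℕ => 1 / β ≤ g n), 1 / g n =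
      ∑ a : ZMod L, (if 1 / β ≤ g a.val then 1 / (76 * β * g a.val) else 0) := by
    rw [Finset.mul_sum, Finset.sum_filter]
    refine Finset.sum_nbij (fun n : ℕ => (n : ZMod L)) (fun n _ => Finset.mem_univ _) ?_ ?_ ?_
    · intro n hn m hm h
      have hn' : n < L := by simpa using hn
      have hm' : m < L := by simpa using hm
      have := congrArg ZMod.val h
      rwa [ZMod.val_cast_of_lt hn', ZMod.val_cast_of_lt hm'] at this
    · intro a _
      exact ⟨a.val, by simpa using ZMod.val_lt a, ZMod.natCast_zmod_val a⟩
    · intro n hn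
      have hn' : n < L := by simpa using hn
      simp only [ZMod.val_cast_of_lt hn']
      split_ifs
      · rw [one_div_mul_one_div]
      · simp
  calc (L : ℝ) / (304 * Real.pi * β) * (Real.log β - Real.log 128)
      = (1 / (76 * β)) * ((L : ℝ) / (4 * Real.pi) * (Real.log β - Real.log 128)) := by
        field_simp; ring
    _ ≤ (1 / (76 * β)) * ∑ n ∈ (Finset.range L).filter (fun n : ℕ => 1 / β ≤ g n), 1 / g n :=
        mul_le_mul_of_nonneg_left key (by positivity)
    _ = ∑ a : ZMod L, (if 1 / β ≤ g a.val then 1 / (76 * β * g a.val) else 0) := hsum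
    _ ≤ ∑ a : ZMod L, (Real.log ((1 + Real.cosh (β * Real.sqrt ((torusBand L ![a, b] - (-2)) ^ 2 + (2 * Real.sqrt 2 * (1 / β) * dWaveGap ![a, b]) ^ 2))) / 2) - Real.log ((1 + Real.cosh (β * (torusBand L ![a, b] - (-2)))) / 2)) := Finset.sum_le_sum fun a _ => hpt a

/-! ### J.4 The free gain at `μ = −2`, `h = 1/β`, `L ≥ 2β` carries the Cooper logarithm -/

/-- **Thermal Cooper logarithm of the free sourced torus**: for `L ≥ 400`, `β ≥ 128`, `L ≥ 2β`,
`p̃_L(β,−2,0,1/β) − p̃_L(β,−2,0,0) ≥ (log β − log 128)/(2736π β²)`. -/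
theorem free_gain_thermal_lower_bound (L : ℕ) [NeZero L] (hL : (400 : ℝ) ≤ L) {β : ℝ} (hβ : 128 ≤ β)
    (hLβ : 2 * β ≤ L) :
    (Real.log β - Real.log 128) / (2736 * Real.pi * β ^ 2) ≤
      (Real.log (partitionFn β (dWaveSourceTorus L 0 (-2) (1 / β))).re / (β * (L : ℝ) ^ 2)) - (Real.log (partitionFn β (dWaveSourceTorus L 0 (-2) 0)).re / (β * (L : ℝ) ^ 2)) := by
  have hπ := Real.pi_pos
  have hβ0 : 0 < β := by linarith
  have hLr : (0 : ℝ) < L := by linarith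
  have hL3 : 3 ≤ L := by exact_mod_cast (show (3 : ℝ) ≤ L by linarith)
  have hlog : 0 ≤ Real.log β - Real.log 128 := by
    have := Real.log_le_log (by norm_num) hβ; linarith
  rw [free_gain_eq L hL3, sum_torusSite_two_eq]
  -- the good rows `b = 0, 1, …, ⌊L/9⌋`
  have hGlt : ∀ n ∈ Finset.range (L / 9 + 1), n < L := by
    intro n hn
    rw [Finset.mem_range] at hn
    have : L / 9 < L := Nat.div_lt_self (Nat.pos_of_ne_zero (NeZero.ne L)) (by norm_num)
    omega
  have hinj : Set.InjOn (fun n : ℕ => (n : ZMod L)) ↑(Finset.range (L / 9 + 1)) := by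
    intro n hn m hm h
    have := congrArg ZMod.val h
    rwa [ZMod.val_cast_of_lt (hGlt n hn), ZMod.val_cast_of_lt (hGlt m hm)] at this
  set GB : Finset (ZMod L) := (Finset.range (L / 9 + 1)).image (fun n : ℕ => (n : ZMod L)) with hGB
  have hGBcard : (L : ℝ) / 9 ≤ (GB.card : ℝ) := by
    rw [hGB, Finset.card_image_of_injOn hinj, Finset.card_range]
    have h9 := Nat.lt_div_mul_add (show 0 < 9 by norm_num) (a := L)
    have h9r : (L : ℝ) < (L / 9 : ℕ) * 9 + 9 := by exact_mod_cast h9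
    rw [div_le_iff₀ (by norm_num : (0 : ℝ) < 9)]
    push_cast
    linarith
  have hcos : ∀ b ∈ GB, 3 / 4 ≤ Real.cos (2 * Real.pi * (b.val : ℝ) / L) := by
    intro b hb
    rw [hGB, Finset.mem_image] at hb
    obtain ⟨n, hn, rfl⟩ := hb
    rw [ZMod.val_cast_of_lt (hGlt n hn)]
    rw [Finset.mem_range] at hn
    have hn9 : (n : ℝ) ≤ L / 9 := by
      have h1 : ((L / 9 : ℕ) : ℝ) ≤ L / 9 := Nat.cast_div_le
      exact le_trans (by exact_mod_cast (show n ≤ L / 9 by omega)) h1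
    set x : ℝ := 2 * Real.pi * (n : ℝ) / L with hx
    have hxle : x ≤ 0.7 := by
      rw [hx, div_le_iff₀ hLr]
      have := Real.pi_lt_d2
      nlinarith
    have hx0 : 0 ≤ x := by positivity
    have hcx := Real.one_sub_sq_div_two_le_cos (x := x)
    nlinarith
  have hrow : ∀ b ∈ GB, (L : ℝ) / (304 * Real.pi * β) * (Real.log β - Real.log 128) ≤
      ∑ a : ZMod L, (Real.log ((1 + Real.cosh (β * Real.sqrt ((torusBand L ![a, b] - (-2)) ^ 2 + (2 * Real.sqrt 2 * (1 / β) * dWaveGap ![a, b]) ^ 2))) / 2) - Real.log ((1 + Real.cosh (β * (torusBand L ![a, b] - (-2)))) / 2)) := fun b hb =>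
    torusRow_modeGain_sum_ge hL hβ hLβ b (hcos b hb)
  have hX : 0 ≤ (L : ℝ) / (304 * Real.pi * β) * (Real.log β - Real.log 128) := by positivity
  have htotal : (L : ℝ) ^ 2 * (Real.log β - Real.log 128) / (2736 * Real.pi * β) ≤
      ∑ b : ZMod L, ∑ a : ZMod L, (Real.log ((1 + Real.cosh (β * Real.sqrt ((torusBand L ![a, b] - (-2)) ^ 2 + (2 * Real.sqrt 2 * (1 / β) * dWaveGap ![a, b]) ^ 2))) / 2) - Real.log ((1 + Real.cosh (β * (torusBand L ![a, b] - (-2)))) / 2)) := by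
    calc (L : ℝ) ^ 2 * (Real.log β - Real.log 128) / (2736 * Real.pi * β)
        = (L : ℝ) / 9 * ((L : ℝ) / (304 * Real.pi * β) * (Real.log β - Real.log 128)) := by
          field_simp; ring
      _ ≤ (GB.card : ℝ) * ((L : ℝ) / (304 * Real.pi * β) * (Real.log β - Real.log 128)) :=
          mul_le_mul_of_nonneg_right hGBcard hX
      _ = ∑ _b ∈ GB, (L : ℝ) / (304 * Real.pi * β) * (Real.log β - Real.log 128) := by
          rw [Finset.sum_const, nsmul_eq_mul]
      _ ≤ ∑ b ∈ GB, ∑ a : ZMod L, (Real.log ((1 + Real.cosh (β * Real.sqrt ((torusBand L ![a, b] - (-2)) ^ 2 + (2 * Real.sqrt 2 * (1 / β) * dWaveGap ![a, b]) ^ 2))) / 2) - Real.log ((1 + Real.cosh (β * (torusBand L ![a, b] - (-2)))) / 2)) := Finset.sum_le_sum hrow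
      _ ≤ ∑ b : ZMod L, ∑ a : ZMod L, (Real.log ((1 + Real.cosh (β * Real.sqrt ((torusBand L ![a, b] - (-2)) ^ 2 + (2 * Real.sqrt 2 * (1 / β) * dWaveGap ![a, b]) ^ 2))) / 2) - Real.log ((1 + Real.cosh (β * (torusBand L ![a, b] - (-2)))) / 2)) :=
          Finset.sum_le_sum_of_subset_of_nonneg (Finset.subset_univ _) fun b _ _ =>
            Finset.sum_nonneg fun a _ => modeGain_nonneg L hβ0.le _ _ _
  have hβL : 0 < β * (L : ℝ) ^ 2 := by positivity
  rw [le_div_iff₀ hβL]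
  calc (Real.log β - Real.log 128) / (2736 * Real.pi * β ^ 2) * (β * (L : ℝ) ^ 2)
      = (L : ℝ) ^ 2 * (Real.log β - Real.log 128) / (2736 * Real.pi * β) := by
        field_simp
    _ ≤ _ := htotal

/-! ### J.5 The refutations -/

/-- The no-log crux implies the no-log thermal-disc statement (restriction). [folklore] -/
theorem twThermalDiscNoLog_of_noLog (H : ∀ μ₁ μ₂ : ℝ, -4 < μ₁ → μ₁ ≤ μ₂ → μ₂ < 0 → ∃ U₀ a C : ℝ, 0 < U₀ ∧ 0 < a ∧ 0 < C ∧ ∀ U : ℝ, 0 < U →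
    U ≤ U₀ → ∀ β : ℝ, 1 ≤ β → β ≤ Real.exp (a / U) → ∀ μ ∈ Set.Icc μ₁ μ₂, ∃ L₀ : ℕ,
      ∀ (L : ℕ) [NeZero L], L₀ ≤ L → ∀ h : ℝ,
        (Real.log (Matrix.partitionFn β (dWaveSourceTorus L U μ h)).re / (β * (L : ℝ) ^ 2)) -
          (Real.log (Matrix.partitionFn β (dWaveSourceTorus L U μ 0)).re / (β * (L : ℝ) ^ 2)) ≤
          C * h ^ 2) :
    ∀ μ₁ μ₂ : ℝ, -4 < μ₁ → μ₁ ≤ μ₂ → μ₂ < 0 → ∃ U₀ a C : ℝ, 0 < U₀ ∧ 0 < a ∧ 0 < C ∧ ∀ U : ℝ, 0 < U →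
    U ≤ U₀ → ∀ β : ℝ, 1 ≤ β → β ≤ Real.exp (a / U) → ∀ μ ∈ Set.Icc μ₁ μ₂, ∃ L₀ : ℕ,
      ∀ (L : ℕ) [NeZero L], L₀ ≤ L → ∀ h : ℝ, |h| ≤ 1 / β →
        (Real.log (Matrix.partitionFn β (dWaveSourceTorus L U μ h)).re / (β * (L : ℝ) ^ 2)) -
          (Real.log (Matrix.partitionFn β (dWaveSourceTorus L U μ 0)).re / (β * (L : ℝ) ^ 2)) ≤
          C * h ^ 2 := by
  intro μ₁ μ₂ h1 h2 h3
  obtain ⟨U₀, a, C, hU₀, ha, hC, hmain⟩ := H μ₁ μ₂ h1 h2 h3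
  refine ⟨U₀, a, C, hU₀, ha, hC, fun U hU hUU₀ β hβ hβa μ hμ => ?_⟩
  obtain ⟨L₀, hL₀⟩ := hmain U hU hUU₀ β hβ hβa μ hμ
  exact ⟨L₀, fun L _ hL h _ => hL₀ L hL h⟩

/-- **Even in the thermal disc the `log β` cannot be dropped.** Witness:
`μ₁ = μ₂ = −2`, `β = 128·exp(2736π(C+2))`, `U = min(U₀, a/(1+log β), 1/(2β²))`,
`L = max(L₀, 400, ⌈2β⌉)`, `h = 1/β`: the free thermal Cooper logarithm (J.4) gives
`G_U(1/β) ≥ (C+2)/β² − 2U ≥ (C+1)/β² > C/β²`. -/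
theorem tw1696_noLog_disc_false : ¬ (∀ μ₁ μ₂ : ℝ, -4 < μ₁ → μ₁ ≤ μ₂ → μ₂ < 0 → ∃ U₀ a C : ℝ, 0 < U₀ ∧ 0 < a ∧ 0 < C ∧ ∀ U : ℝ, 0 < U →
    U ≤ U₀ → ∀ β : ℝ, 1 ≤ β → β ≤ Real.exp (a / U) → ∀ μ ∈ Set.Icc μ₁ μ₂, ∃ L₀ : ℕ,
      ∀ (L : ℕ) [NeZero L], L₀ ≤ L → ∀ h : ℝ, |h| ≤ 1 / β →
        (Real.log (Matrix.partitionFn β (dWaveSourceTorus L U μ h)).re / (β * (L : ℝ) ^ 2)) -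
          (Real.log (Matrix.partitionFn β (dWaveSourceTorus L U μ 0)).re / (β * (L : ℝ) ^ 2)) ≤
          C * h ^ 2) := by
  intro H
  obtain ⟨U₀, a, C, hU₀, ha, hC, hmain⟩ := H (-2) (-2) (by norm_num) le_rfl (by norm_num)
  have hπ := Real.pi_pos
  set K : ℝ := 2736 * Real.pi with hK
  have hKpos : 0 < K := by positivity
  set β : ℝ := 128 * Real.exp (K * (C + 2)) with hβdef
  have hexp1 : 1 ≤ Real.exp (K * (C + 2)) := Real.one_le_exp (by positivity)
  have hβ128 : 128 ≤ β := by rw [hβdef]; nlinarith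
  have hβ1 : 1 ≤ β := by linarith
  have hβ0 : 0 < β := by linarith
  have hlogβ : Real.log β = Real.log 128 + K * (C + 2) := by
    rw [hβdef, Real.log_mul (by norm_num) (Real.exp_pos _).ne', Real.log_exp]
  have hlog0 : 0 ≤ Real.log β := Real.log_nonneg hβ1
  set U : ℝ := min U₀ (min (a / (1 + Real.log β)) (1 / (2 * β ^ 2))) with hUdef
  have hUpos : 0 < U := lt_min hU₀ (lt_min (div_pos ha (by linarith)) (by positivity))
  have hUU₀ : U ≤ U₀ := min_le_left _ _
  have hUa : U ≤ a / (1 + Real.log β) := (min_le_right _ _).trans (min_le_left _ _)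
  have hUq : U ≤ 1 / (2 * β ^ 2) := (min_le_right _ _).trans (min_le_right _ _)
  have hβexp : β ≤ Real.exp (a / U) := le_exp_div_of_le hUpos hβ1 hUa
  obtain ⟨L₀, hL₀⟩ := hmain U hUpos hUU₀ β hβ1 hβexp (-2) ⟨le_rfl, le_rfl⟩
  set L : ℕ := max L₀ (max 400 ⌈2 * β⌉₊) with hLdef
  have hLL₀ : L₀ ≤ L := le_max_left _ _
  have hL400 : 400 ≤ L := (le_max_left _ _).trans (le_max_right _ _)
  have hLceil : ⌈2 * β⌉₊ ≤ L := (le_max_right _ _).trans (le_max_right _ _)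
  have hLβ : 2 * β ≤ L := (Nat.le_ceil _).trans (by exact_mod_cast hLceil)
  haveI : NeZero L := ⟨by omega⟩
  have hL400r : (400 : ℝ) ≤ L := by exact_mod_cast hL400
  have hh : |1 / β| ≤ 1 / β := by rw [abs_of_pos (by positivity)]
  have hup : (Real.log (partitionFn β (dWaveSourceTorus L U (-2) (1 / β))).re / (β * (L : ℝ) ^ 2)) - (Real.log (partitionFn β (dWaveSourceTorus L U (-2) 0)).re / (β * (L : ℝ) ^ 2)) ≤ C * (1 / β) ^ 2 :=
    hL₀ L hLL₀ (1 / β) hh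
  have hfree := free_gain_thermal_lower_bound L hL400r hβ128 hLβ
  have htrans := free_gain_sub_le_gain L U (-2) (1 / β) hβ0
  rw [abs_of_pos hUpos] at htrans
  have hval : (Real.log β - Real.log 128) / (2736 * Real.pi * β ^ 2) = (C + 2) / β ^ 2 := by
    rw [hlogβ, ← hK]; field_simp; ring
  rw [hval] at hfree
  have h2U : 2 * U ≤ 1 / β ^ 2 := by
    calc 2 * U ≤ 2 * (1 / (2 * β ^ 2)) := by linarith
      _ = 1 / β ^ 2 := by field_simp
  have hfin : (C + 2) / β ^ 2 - 1 / β ^ 2 ≤ C * (1 / β) ^ 2 := by linarith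
  rw [div_sub_div_same, show C * (1 / β) ^ 2 = C / β ^ 2 by field_simp,
    div_le_div_iff_of_pos_right (by positivity)] at hfin
  linarith

/-- **The `log β` of the crux is load-bearing**: the crux with bound `C·h²` is false. -/
theorem tw1696_noLog_false : ¬ (∀ μ₁ μ₂ : ℝ, -4 < μ₁ → μ₁ ≤ μ₂ → μ₂ < 0 → ∃ U₀ a C : ℝ, 0 < U₀ ∧ 0 < a ∧ 0 < C ∧ ∀ U : ℝ, 0 < U →
    U ≤ U₀ → ∀ β : ℝ, 1 ≤ β → β ≤ Real.exp (a / U) → ∀ μ ∈ Set.Icc μ₁ μ₂, ∃ L₀ : ℕ,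
      ∀ (L : ℕ) [NeZero L], L₀ ≤ L → ∀ h : ℝ,
        (Real.log (Matrix.partitionFn β (dWaveSourceTorus L U μ h)).re / (β * (L : ℝ) ^ 2)) -
          (Real.log (Matrix.partitionFn β (dWaveSourceTorus L U μ 0)).re / (β * (L : ℝ) ^ 2)) ≤
          C * h ^ 2) :=
  fun H => tw1696_noLog_disc_false (twThermalDiscNoLog_of_noLog H)

end LogLoadBearing

end Summit.HubbardSuperconductivity.HubbardSuperconductivity.Theorems.TwSourcedInertness.Negative
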